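import Mathlib.Analysis.InnerProductSpace.PiL2
import Mathlib.Analysis.SpecialFunctions.Pow.Real
import Mathlib.Analysis.Calculus.FDeriv.Equiv
import Mathlib.Analysis.Calculus.FDeriv.Mul
import HarnessLib

/-!
# Stub Z5 `stub_defect_dilate` for crux `MoebiusLimitExists` (stmt-CriticalPhenomena-1344), line `Sketch` v16
(lead prover-line-stmt-CriticalPhenomena-1344-c19-0; THEOREM-ONLY, `--supports stmt-CriticalPhenomena-1344`)

**The pointwise special-conformal defect of a scale-covariant level is dilation homogeneous of degree `1 − nΔ`.**
For one level `F : (ℝ³)ⁿ → ℝ` and a generator `b ∈ ℝ³` the pointwise SCT defect is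
`E_b(F)(x) := DF(x)[(‖xᵢ‖² b − 2⟪b,xᵢ⟫ xᵢ)ᵢ] − 2Δ (Σᵢ ⟪b,xᵢ⟫) F(x)`.
If `F (t • y) = t^{−nΔ} F(y)` for all `t > 0` and `F` is differentiable at `x`, then for every `t > 0`
`E_b(F)(t • x) = t^{1−nΔ} E_b(F)(x)`.

Proof. Fix `t > 0` and put `c := t^{−nΔ}`. The map `G := fun y ↦ F (t • y)` equals `fun y ↦ c * F y`, so it has
Fréchet derivative `c • DF(x)` at `x`; and `F = G ∘ (t⁻¹ • ·)`, so by the chain rule `F` is differentiable at `t • x`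
with `DF(t • x)[t • v] = c · DF(x)[v]`. The SCT vector field satisfies `K_b(t • x) = t • (t • K_b(x))`
(`‖t xᵢ‖² = t² ‖xᵢ‖²`, `⟪b, t xᵢ⟫ = t ⟪b, xᵢ⟫`), so the derivative term at `t • x` is `c t · DF(x)[K_b(x)]`; the scalar
term is `2Δ · t Σ⟪b,xᵢ⟫ · c F(x)`; and `t^{1−nΔ} = t · c`.

References: standard (dilation covariance of the conformal Ward identities, e.g. Di Francesco–Mathieu–Sénéchal 1997,
§4.1). No definitions are introduced.
-/

noncomputable section

namespace Summit.CriticalPhenomena.Ising3DConformalLimit.MoebiusLimitExistsSketchV16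

/-- **Stub Z5 (dilation homogeneity of the SCT defect).** For a level `F : (ℝ³)ⁿ → ℝ` with
`F (t • y) = t^{−nΔ} F(y)` (`t > 0`) differentiable at `x`, the pointwise special-conformal defect
`E_b(F)(x) = DF(x)[(‖xᵢ‖² b − 2⟪b,xᵢ⟫ xᵢ)ᵢ] − 2Δ (Σᵢ⟪b,xᵢ⟫) F(x)` satisfies `E_b(F)(t • x) = t^{1−nΔ} E_b(F)(x)`
for every `t > 0` (chain rule for the dilation `y ↦ t • y`, `DF(t x)[t v] = t^{−nΔ} DF(x)[v]`, and
`K_b(t x) = t² K_b(x)`). [folklore] -/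
theorem stub_defect_dilate : ∀ (n : ℕ) (F : (Fin n → EuclideanSpace ℝ (Fin 3)) → ℝ) (Δ : ℝ)
    (x : Fin n → EuclideanSpace ℝ (Fin 3)), DifferentiableAt ℝ F x →
    (∀ t : ℝ, 0 < t → ∀ y : Fin n → EuclideanSpace ℝ (Fin 3), F (fun i => t • y i) = t ^ (-(n : ℝ) * Δ) * F y) →
    ∀ (b : EuclideanSpace ℝ (Fin 3)) (t : ℝ), 0 < t →
    fderiv ℝ F (fun i => t • x i) (fun i => ‖t • x i‖ ^ 2 • b - (2 * inner ℝ b (t • x i)) • (t • x i)) -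
        2 * Δ * (∑ i, inner ℝ b (t • x i)) * F (fun i => t • x i) =
      t ^ (1 - (n : ℝ) * Δ) *
        (fderiv ℝ F x (fun i => ‖x i‖ ^ 2 • b - (2 * inner ℝ b (x i)) • x i) - 2 * Δ * (∑ i, inner ℝ b (x i)) * F x) := by
  intro n F Δ x hF hcov b t ht
  have ht0 : t ≠ 0 := ht.ne'
  -- Step 1: `F` is differentiable at `t • x`, with derivative `t^{-nΔ} • DF(x) ∘ (t⁻¹ • id)`.
  have hderiv : HasFDerivAt F ((t ^ (-(n : ℝ) * Δ) • fderiv ℝ F x).comp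
      (t⁻¹ • ContinuousLinearMap.id ℝ (Fin n → EuclideanSpace ℝ (Fin 3)))) (fun i => t • x i) := by
    -- `G := F ∘ (t • ·) = t^{-nΔ} * F` is differentiable at `x`
    have h1 : (fun y : Fin n → EuclideanSpace ℝ (Fin 3) => F (fun i => t • y i))
        = fun y => t ^ (-(n : ℝ) * Δ) * F y :=
      funext fun y => hcov t ht y
    have hG : HasFDerivAt (fun y : Fin n → EuclideanSpace ℝ (Fin 3) => F (fun i => t • y i))
        (t ^ (-(n : ℝ) * Δ) • fderiv ℝ F x) x := by
      rw [h1]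
      exact hF.hasFDerivAt.const_mul _
    have hx : (t⁻¹ • fun i => t • x i) = x := by
      funext i
      simp only [Pi.smul_apply, smul_smul, inv_mul_cancel₀ ht0, one_smul]
    have hG' : HasFDerivAt (fun y : Fin n → EuclideanSpace ℝ (Fin 3) => F (fun i => t • y i))
        (t ^ (-(n : ℝ) * Δ) • fderiv ℝ F x) (t⁻¹ • fun i => t • x i) := by
      rw [hx]
      exact hG
    have hD : HasFDerivAt (fun z : Fin n → EuclideanSpace ℝ (Fin 3) => t⁻¹ • z)
        (t⁻¹ • ContinuousLinearMap.id ℝ (Fin n → EuclideanSpace ℝ (Fin 3))) (fun i => t • x i) :=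
      (hasFDerivAt_id _).const_smul t⁻¹
    have hcomp := hG'.comp (fun i => t • x i) hD
    have h2 : ((fun y : Fin n → EuclideanSpace ℝ (Fin 3) => F (fun i => t • y i)) ∘
        fun z : Fin n → EuclideanSpace ℝ (Fin 3) => t⁻¹ • z) = F := by
      funext z
      simp only [Function.comp_apply, Pi.smul_apply, smul_smul, mul_inv_cancel₀ ht0, one_smul]
    rwa [h2] at hcomp
  -- Step 2: `DF(t • x)[t • v] = t^{-nΔ} DF(x)[v]`.
  have hfd : ∀ v : Fin n → EuclideanSpace ℝ (Fin 3),
      fderiv ℝ F (fun i => t • x i) (t • v) = t ^ (-(n : ℝ) * Δ) * fderiv ℝ F x v := by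
    intro v
    rw [hderiv.fderiv]
    simp only [ContinuousLinearMap.comp_apply, smul_apply,
      ContinuousLinearMap.id_apply, smul_smul, inv_mul_cancel₀ ht0, one_smul, smul_eq_mul]
  -- Step 3: the SCT vector field is homogeneous of degree two.
  have hKvec : (fun i => ‖t • x i‖ ^ 2 • b - (2 * inner ℝ b (t • x i)) • (t • x i))
      = t • (t • fun i => ‖x i‖ ^ 2 • b - (2 * inner ℝ b (x i)) • x i) := by
    funext i
    simp only [Pi.smul_apply, smul_sub, smul_smul, norm_smul, Real.norm_eq_abs, abs_of_pos ht,
      real_inner_smul_right]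
    module
  -- Step 4: the scalar term and the exponent bookkeeping.
  have hsum : ∑ i, inner ℝ b (t • x i) = t * ∑ i, inner ℝ b (x i) := by
    rw [Finset.mul_sum]
    exact Finset.sum_congr rfl fun i _ => real_inner_smul_right _ _ _
  have hFt : F (fun i => t • x i) = t ^ (-(n : ℝ) * Δ) * F x := hcov t ht x
  have hpow : t ^ (1 - (n : ℝ) * Δ) = t * t ^ (-(n : ℝ) * Δ) := by
    rw [neg_mul, sub_eq_add_neg, Real.rpow_add ht, Real.rpow_one]
  rw [hKvec, hfd, map_smul, smul_eq_mul, hsum, hFt, hpow]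
  ring

end Summit.CriticalPhenomena.Ising3DConformalLimit.MoebiusLimitExistsSketchV16

end
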